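import Literature.NumberTheory.LFunctions.YoshidaWindowGramColumnData
import HarnessLib

/-!
# C∞ rung `R1E` (even sector) — DATA `FFN` part 1/1

Route context: Fourier–Galerkin / Schur-complement certificates of Weil positivity on a window ("format C", C∞ door `weilPositivityOn_of_cinf_pipeline`); supporting stmt-RiemannHypothesis-0098; seat rh-explicit-weil-2 (`cinfemit.py`/`emit_lean2.py`, HOME/rh-explicit-weil-2/gen17/EMITTER-PHASE2.md). Data / bookkeeping only; standard axioms; no RH claim.
-/

set_option autoImplicit false
-- `Summit.RiemannHypothesis.RiemannHypothesis.…` is the layout-mandated namespace (summit = problem name).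
set_option linter.dupNamespace false

namespace Summit.RiemannHypothesis.RiemannHypothesis.Theorems.WeilFormatC

open Literature.NumberTheory.LFunctions

namespace CinfR1E

/-- Packed rows part 1/1 of table `FFN` (word width 370, 4 words). -/
def FFN_P : List ℕ := [
  0x7fffffffffcaee304f66d0bf65626201d3a9f50cfe0f158b4602b0f6ad97e66899c92aa691f166a201047452332a600000000000005824e3a2a7e6a42b7a5a49ea66ff55834c7f3d1691777569d62bc81d62d9e897388a37589cf15d77ffffffffffffffff75536db3efa071660b8689ed6382d10979404c18a3359768d1a8bfb5e5644aad270cf927474200000000000000000000ba31f16881d7a01a018035676aac3aaf1bf21e3a09241f3c2fcbbc42ed9d3b1907375858,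
  0x80000009e682450543d7878fc3f653ef62303d069c3785190f8c1280a9358506241788bee4a4cfe063bba53d2359dfffffffffef8ec003793e21f90d575290d2cd2cd25d86172bee20f99821e8827a2aa51cc8eaa2719ab56ff3ae035800000000000019dbf43ac0653787ae5753b481198db7a60638f9b235f1ea2493e0cdd11078f2ea67476c4b583df1ffffffffffffffffdd54db6cfbe81c5982e1a27b58e0b4425e50130628cd65da346a2fed795912ab49c33e49d1d0,
  0x7ffe6d123ae546a832e6d478300a14f2fe7c4627ac0c7e064961fc93e55838b21a5c632ef83664b31f27645d46b7200000029d2924b07512eee3f57ece50030d4c35f6066115034ff5b50d478f057439dd908a4337bfabd07e275d76a7fffffffffbe3b000de4f887e4355d4a434b34b34976185cafb883e66087a209e8aa947323aa89c66ad5bfceb80d600000000000005824e3a2a7e6a42b7a5a49ea66ff55834c7f3d1691777569d62bc81d62d9e897388a37589cf15d7,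
  0xbca7bda7e1e1dd692fd65e314f827ba7609a8b354606e7ed88405406ec57114c17abb79a46ec1a56edd8eb0587bc1fff9b448eb951aa0cb9b51e0c02853cbf9f1189eb031f8192587f24f9560e2c869718cbbe0d992cc7c9d91751adc80000009e682450543d7878fc3f653ef62303d069c3785190f8c1280a9358506241788bee4a4cfe063bba53d2359dffffffffff2bb8c13d9b42fd958988074ea7d433f83c562d180ac3dab65f99a26724aa9a47c59a880411d148cca9]

end CinfR1E

end Summit.RiemannHypothesis.RiemannHypothesis.Theorems.WeilFormatC
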